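import Summits.AtomisticToContinuum.HydrodynamicLimit.Theorems.LocalSecondLaw.Negative.Functional
import Literature.MathematicalPhysics.KineticTheory.HardSphereUniformGas
import HarnessLib

/-!
# Mean kinetic energy of the homogeneous local Gibbs law (refutation of `MeanSecondLaw`, stub P5)

Stub `P5` of the refutation line of the crux `AnnealedZeroHorizon.MeanSecondLaw`
(stmt-AtomisticToContinuum-9257).  For the homogeneous data `(a₀, u₀, θ₀) = (1, 0, θ)` and reduced
diameter `σ ≤ 1/2`, the time-`0` law `P_N = localGibbsLaw σ 1 0 θ N Φ` of `N + 1` hard spheres is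
the image under `zipConfig` of `posGibbsMeasure ⊗ (⊗ᵢ N(0, θ id))` (the tree's rung-`0` product
structure `localGibbsMeasure_rung0_eq_map`): positions and velocities are independent, the position
marginal is a probability measure (`σ ≤ 1/2`), and the `N + 1` velocities are i.i.d. centred
Maxwellians of temperature `θ` on `ℝ³`.  Hence the mean kinetic energy per particle
`ke w = (N+1)⁻¹ Σᵢ |vᵢ|²/2` is integrable (Gaussian second moments) with

  `E[ke] = (N+1)⁻¹ Σᵢ E |vᵢ|²/2 = (N+1)⁻¹ (N+1) (3θ/2) = 3θ/2`

(`integral_energy_gaussMeasure`: `E |v|²/2 = |u|²/2 + dim θ/2` under `N(u, θ id)`).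

No definitions; helper lemmas live in the sub-namespace `MeanKineticEnergy`.
-/

noncomputable section

namespace Summit.AtomisticToContinuum.HydrodynamicLimit.Theorems.MeanSecondLawRefutation

open MeasureTheory Filter Set Topology
open scoped ENNReal
open Literature.MathematicalPhysics.KineticTheory Literature.Analysis.FluidPDE
open LocalSecondLawNegative (ke)

namespace MeanKineticEnergy

/-! ### One particle: the kinetic energy under the centred Maxwellian `N(0, θ id)` on `ℝ³` -/

/-- `|v|²/2` is integrable under `gaussMeasure 0 θ` (Gaussian second moments). [folklore] -/
theorem integrable_half_norm_sq (θ : ℝ) :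
    Integrable (fun v : V3 => ‖v‖ ^ 2 / 2) (gaussMeasure (0 : V3) θ) := by
  have h := (memLp_energy_gaussMeasure (ι := Fin 3) (0 : V3) θ 0).integrable one_le_two
  simp only [sub_zero] at h
  exact h

/-- `E |v|²/2 = 3θ/2` under `gaussMeasure 0 θ` on `ℝ³` (`integral_energy_gaussMeasure` with
`u = 0`, `dim = 3`). [folklore] -/
theorem integral_half_norm_sq {θ : ℝ} (hθ : 0 < θ) :
    ∫ v, ‖v‖ ^ 2 / 2 ∂gaussMeasure (0 : V3) θ = 3 / 2 * θ := by
  have h := integral_energy_gaussMeasure (ι := Fin 3) (0 : V3) (θ := θ) hθ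
  have hfun : (fun v : V3 => ‖v‖ ^ 2 / 2 - ‖(0 : V3)‖ ^ 2 / 2 - (Fintype.card (Fin 3) : ℝ) * θ / 2) =
      fun v => ‖v‖ ^ 2 / 2 - 3 / 2 * θ := by
    funext v
    rw [norm_zero, Fintype.card_fin]
    push_cast
    ring
  rw [hfun, integral_sub (integrable_half_norm_sq θ) (integrable_const _), integral_const,
    smul_eq_mul, probReal_univ, one_mul] at h
  linarith

/-! ### `N + 1` particles: the mean kinetic energy under the velocity marginal `⊗ᵢ N(0, θ id)` -/

/-- `v ↦ (N+1)⁻¹ Σᵢ |vᵢ|²/2` is integrable under `⊗ᵢ N(0, θ id)` (finite sum of integrable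
coordinates, `integrable_comp_eval`). [folklore] -/
theorem integrable_velocityEnergy (θ : ℝ) (N : ℕ) :
    Integrable (fun v : Fin (N + 1) → V3 => ((N + 1 : ℕ) : ℝ)⁻¹ * ∑ i, ‖v i‖ ^ 2 / 2)
      (Measure.pi fun _ : Fin (N + 1) => gaussMeasure (0 : V3) θ) := by
  refine Integrable.const_mul (integrable_finsetSum _ fun i _ => ?_) _
  exact integrable_comp_eval (μ := fun _ : Fin (N + 1) => gaussMeasure (0 : V3) θ)
    (f := fun w : V3 => ‖w‖ ^ 2 / 2) (integrable_half_norm_sq θ)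

/-- `E[(N+1)⁻¹ Σᵢ |vᵢ|²/2] = 3θ/2` under `⊗ᵢ N(0, θ id)` (linearity, `integral_comp_eval`, and the
one-particle value `3θ/2`). [folklore] -/
theorem integral_velocityEnergy {θ : ℝ} (hθ : 0 < θ) (N : ℕ) :
    ∫ v, ((N + 1 : ℕ) : ℝ)⁻¹ * ∑ i, ‖v i‖ ^ 2 / 2
        ∂(Measure.pi fun _ : Fin (N + 1) => gaussMeasure (0 : V3) θ) = 3 / 2 * θ := by
  have hi : ∀ i : Fin (N + 1), Integrable (fun v : Fin (N + 1) → V3 => ‖v i‖ ^ 2 / 2)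
      (Measure.pi fun _ : Fin (N + 1) => gaussMeasure (0 : V3) θ) := fun i =>
    integrable_comp_eval (μ := fun _ : Fin (N + 1) => gaussMeasure (0 : V3) θ)
      (f := fun w : V3 => ‖w‖ ^ 2 / 2) (integrable_half_norm_sq θ)
  have hval : ∀ i : Fin (N + 1), ∫ v, ‖v i‖ ^ 2 / 2
      ∂(Measure.pi fun _ : Fin (N + 1) => gaussMeasure (0 : V3) θ) = 3 / 2 * θ := fun i => by
    rw [integral_comp_eval (μ := fun _ : Fin (N + 1) => gaussMeasure (0 : V3) θ)
      (f := fun w : V3 => ‖w‖ ^ 2 / 2) (by fun_prop), integral_half_norm_sq hθ]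
  rw [integral_const_mul, integral_finsetSum Finset.univ fun i _ => hi i]
  simp_rw [hval]
  rw [Finset.sum_const, Finset.card_univ, Fintype.card_fin, nsmul_eq_mul]
  have hN : ((N + 1 : ℕ) : ℝ) ≠ 0 := by positivity
  field_simp

/-- The mean kinetic energy of a zipped configuration depends on the velocities only:
`ke (zipConfig (x, v)) = (N+1)⁻¹ Σᵢ |vᵢ|²/2`. [folklore] -/
theorem ke_zipConfig {N : ℕ} (p : (Fin (N + 1) → T3) × (Fin (N + 1) → V3)) :
    ke (zipConfig p) = ((N + 1 : ℕ) : ℝ)⁻¹ * ∑ i, ‖p.2 i‖ ^ 2 / 2 := by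
  simp only [LocalSecondLawNegative.ke, zipConfig_apply]

end MeanKineticEnergy

/-- **Mean kinetic energy per particle under the homogeneous local Gibbs law** `(1, θ, 0)`, `σ ≤ 1/2`:
`ke` is integrable and `E[ke] = 3θ/2` (positions and velocities independent, velocities i.i.d.
`N(0, θ id)`: `integral_localGibbsLaw_rung0`, `integral_energy_gaussMeasure`). [folklore] -/
theorem meanKineticEnergy_homogeneous {σ θ : ℝ} (hσ : σ ≤ 1 / 2) (hθ : 0 < θ) (N : ℕ)
    (Φ : HardSphereFlow (Torus.geometry (Fin 3)) (hsDiameter σ N) (N + 1)) :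
    Integrable (ke (N := N)) (localGibbsLaw σ (fun _ => 1) (fun _ => 0) (fun _ => θ) N Φ) ∧
      ∫ w, ke w ∂(localGibbsLaw σ (fun _ => 1) (fun _ => 0) (fun _ => θ) N Φ) = 3 / 2 * θ := by
  haveI : IsProbabilityMeasure (posGibbsMeasure (fun _ : T3 => (1 : ℝ)) (hsDiameter σ N) (N + 1)) :=
    isProbabilityMeasure_posGibbsMeasure continuous_const (fun _ => one_pos) hσ N
  refine ⟨?_, ?_⟩
  · have hz : MeasurableEmbedding
        (zipConfig : (Fin (N + 1) → T3) × (Fin (N + 1) → V3) → Config (N + 1) (Fin 3) T3) :=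
      (MeasurableEquiv.arrowProdEquivProdArrow T3 V3 (Fin (N + 1))).symm.measurableEmbedding
    rw [localGibbsLaw_eq, localGibbsMeasure_rung0_eq_map σ zero_le_one hθ 0 N, hz.integrable_map_iff]
    refine ((MeanKineticEnergy.integrable_velocityEnergy θ N).comp_snd
      (posGibbsMeasure (fun _ : T3 => (1 : ℝ)) (hsDiameter σ N) (N + 1))).congr
      (ae_of_all _ fun p => ?_)
    exact (MeanKineticEnergy.ke_zipConfig p).symm
  · rw [integral_localGibbsLaw_rung0 σ zero_le_one hθ 0 N Φ]
    simp_rw [MeanKineticEnergy.ke_zipConfig]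
    rw [integral_fun_snd (f := fun v : Fin (N + 1) → V3 => ((N + 1 : ℕ) : ℝ)⁻¹ * ∑ i, ‖v i‖ ^ 2 / 2),
      probReal_univ, one_smul, MeanKineticEnergy.integral_velocityEnergy hθ N]

end Summit.AtomisticToContinuum.HydrodynamicLimit.Theorems.MeanSecondLawRefutation

end
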